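import Summits.AtomisticToContinuum.Crystallization.Theorems.ChartedZeroExcessLayeredLatticeLiouvilleZZZYRCXRWD

/-!
# Charted zero-excess layered lattice Liouville — RCXRWF: CLASS tables and the finite KEY BOX (lens-2 g101, Q-K design (i))

Support for the common-table design (i) of the θ-reader (critic r1908 (C4)): the unit door `kernelSlabSoundFE_of_units` (RCXRWD)
yields, per window type `ω`, envelope tables pinned on the WHOLE window (`pinW … (wordZ ω)`), hence `ω`-dependent.  Here

* §1 `pinRep H₀ g u₀` pins only the UP half-window, by the letters of the orbit REPRESENTATIVE `u₀`; the class door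
  `kernelSlabSoundFE_of_units_cls` has the SAME hypotheses as the unit door and concludes with tables that depend only on the
  class data `(u₀, σ, g, g₀, g₁, unit tables)` of the two halves — `16 × 6` CLASS ENVELOPES per direction, no `ω` left;
* §2 the finite KEY BOX `InKeyBox H₀ R G Mp` contains every piece key of valid chord data (`4·P9max < 3(3G+1)²`,
  `P9max < 6(Mp+1)²`): off the box the guarded ideal tables vanish (`thetaR0G_eq_zero_off`), so table domination is needed ON THE
  BOX ONLY — `kernelSlabSoundFE_mono_on` (the `∀ k ∈ ℤ⁴` of `kernelSlabSoundFE_mono` becomes a finite condition; the box is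
  stable under `revKey`).

* §3 tree lookups `PT.findR/findN` (recursor form) and the COMMON TABLES `comTR/comTN H₀ BU BD k = find (codeKO k) BU +
  find (codeKO (revKey H₀ k)) BD` (trees emitted by the census as literals); §4 `strictCodes`.

The decided domination certificate against the trees and its soundness are RCXRWG.  [g101]
-/

namespace Summit.AtomisticToContinuum.Crystallization.Theorems.ChartedZeroExcessLayeredLatticeLiouville.ThetaKernel

open scoped BigOperators

/-! ### §1 class pins and the class door -/

/-- the CLASS pin at layer `m`: the `g`-value of the representative's letter `u₀[m − H₀]` on the up half-window `[H₀, 2H₀]`,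
nothing elsewhere. [g101] -/
def pinRep (H₀ : ℕ) (g : ℤ → ℤ) (u₀ : List ℕ) (m : ℤ) : Option ℤ :=
  if (H₀ : ℤ) ≤ m ∧ m ≤ 2 * (H₀ : ℤ) then some (g ((u₀.getD (m.toNat - H₀) 0 : ℕ) : ℤ)) else none

/-- an assignment admissible for `u₀` on the up half-window has the class pins. [g101] -/
theorem pinRep_spec {ℓ : ℤ → ℤ} (hℓ : IsLetterSeq ℓ) {H₀ : ℕ} {u₀ : List ℕ} {g : ℤ → ℤ}
    (ha : AdmO u₀ (600 + H₀) (600 + 2 * H₀) (rhoOf ℓ)) : ∀ m w, pinRep H₀ g u₀ m = some w → g (ℓ m) = w := by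
  intro m w hm
  unfold pinRep at hm
  split_ifs at hm with hc
  obtain ⟨n, rfl⟩ := Int.eq_ofNat_of_zero_le ((Int.natCast_nonneg H₀).trans hc.1)
  have hn1 : H₀ ≤ n := by exact_mod_cast hc.1
  have hn2 : n ≤ 2 * H₀ := by exact_mod_cast hc.2
  have hw : inWin (600 + H₀) (600 + 2 * H₀) (n + 600) = true := by
    unfold inWin
    rw [Bool.and_eq_true, Nat.ble_eq, Nat.ble_eq]
    omega
  have h1 := ha.1 (n + 600) hw
  have hc1 := rhoOf_cast hℓ (n + 600)
  have e1 : ((n + 600 : ℕ) : ℤ) - 600 = (n : ℤ) := by push_cast; ring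
  rw [e1] at hc1
  have e2 : n + 600 - (600 + H₀) = n - H₀ := by omega
  rw [← Option.some.inj hm, Int.toNat_natCast, ← hc1, h1, e2]

/-- ★★★ THE CLASS DOOR: the hypotheses of `kernelSlabSoundFE_of_units` VERBATIM; the conclusion's tables are pinned by the
representatives `uU`, `uD` only, hence common to all types `ω` of the class pair. [g101] -/
theorem kernelSlabSoundFE_of_units_cls {ω u v uU uD : List ℕ} {H₀ R E M : ℕ} {lo hi P9max : ℤ} {ymsU ymsD : List ℕ}
    {cdU cdD : List ChordDatum} {TRU TNU TRD TND : ℤ × ℤ × ℤ × ℤ → ℤ} {fU' gU fD' gD : ℤ → ℤ} {σU κU gU₀ gU₁ σD κD gD₀ gD₁ : ℤ}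
    (hwl : ω.length = 2 * H₀ + 1) (hu : subWord ω H₀ u = true) (hul : u.length = H₀ + 1) (hv : subWord ω 0 v = true)
    (hvl : v.length = H₀ + 1)
    (hU : KernelSlabSoundOn H₀ R (fun ℓ => AdmO uU (600 + H₀) (600 + 2 * H₀) (rhoOf ℓ)) ymsU lo hi P9max E cdU TRU TNU)
    (hσU : σU * σU = 1) (hcohU : ∀ r : ℤ, 0 ≤ r → r ≤ 2 → 3 * gU (fU' r) + r = σU * fU' r + κU)
    (hgU : ∀ r : ℤ, 0 ≤ r → r ≤ 2 → gU (fU' r) = gU₀ ∨ gU (fU' r) = gU₁) (hfU' : ∀ r : ℤ, 0 ≤ r → r ≤ 2 → 0 ≤ fU' r ∧ fU' r ≤ 2)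
    (hchkU : symWordChk fU' u uU = true)
    (hD : KernelSlabSoundOn H₀ R (fun ℓ => AdmO uD (600 + H₀) (600 + 2 * H₀) (rhoOf ℓ)) ymsD lo hi P9max E cdD TRD TND)
    (hσD : σD * σD = 1) (hcohD : ∀ r : ℤ, 0 ≤ r → r ≤ 2 → 3 * gD (fD' r) + r = σD * fD' r + κD)
    (hgD : ∀ r : ℤ, 0 ≤ r → r ≤ 2 → gD (fD' r) = gD₀ ∨ gD (fD' r) = gD₁) (hfD' : ∀ r : ℤ, 0 ≤ r → r ≤ 2 → 0 ≤ fD' r ∧ fD' r ≤ 2)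
    (hchkD : symWordChk fD' v.reverse uD = true)
    (hdisj : disjUD H₀ ymsU ymsD = true) (hcov : coverUD H₀ M ymsU ymsD = true) (hM : M ≤ 600 + H₀) (hMb : hi < 6 * ((M : ℤ) + 1) ^ 2) :
    KernelSlabSoundFE H₀ R (wordZ ω) lo hi P9max E
      (fun k => envTab σU (pinRep H₀ gU uU) gU₀ gU₁ TRU k + envTab σD (pinRep H₀ gD uD) gD₀ gD₁ TRD (revKey H₀ k))
      fun k => envTab σU (pinRep H₀ gU uU) gU₀ gU₁ TNU k + envTab σD (pinRep H₀ gD uD) gD₀ gD₁ TND (revKey H₀ k) := by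
  refine kernelSlabSoundFE_of_parts hMb fun ℓ'' hℓ'' hag => ?_
  -- UP: the unit of `uU` at the sequence `fU' ∘ ℓ''`, transported to `ℓ''` with the class pins of `uU`
  have hℓU : IsLetterSeq (fun m => fU' (ℓ'' m)) := fun m => hfU' _ (hℓ'' m).1 (hℓ'' m).2
  have haU : AdmO uU (600 + H₀) (600 + 2 * H₀) (rhoOf fun m => fU' (ℓ'' m)) :=
    admO_symW hℓ'' hfU' hchkU (by omega) (admO_rhoOf_sub hℓ'' hwl hag hu (by omega) le_rfl)
  have hPU := kernelSlabSoundOn_iff.mp hU _ hℓU haU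
  have hTU := kernelSlabSoundAtP_sym_env (ℓ' := ℓ'') hσU (fun m => hcohU _ (hℓ'' m).1 (hℓ'' m).2) (pinRep_spec hℓU haU)
    (fun m => hgU _ (hℓ'' m).1 (hℓ'' m).2) hPU
  -- DOWN: the unit of `uD` at `fD' ∘ revLetters (2H₀) ℓ''` with the class pins of `uD`, transported, then reflected to `ℓ''`
  have hℓR : IsLetterSeq (revLetters (2 * (H₀ : ℤ)) ℓ'') := isLetterSeq_revLetters (2 * (H₀ : ℤ)) hℓ''
  have hℓD : IsLetterSeq (fun m => fD' (revLetters (2 * (H₀ : ℤ)) ℓ'' m)) := fun m => hfD' _ (hℓR m).1 (hℓR m).2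
  have haD : AdmO uD (600 + H₀) (600 + 2 * H₀) (rhoOf fun m => fD' (revLetters (2 * (H₀ : ℤ)) ℓ'' m)) :=
    admO_symW hℓR hfD' hchkD (by rw [List.length_reverse]; omega)
      (admO_rev hℓ'' hvl (admO_rhoOf_sub hℓ'' hwl hag hv (by omega) (by omega)))
  have hPD := kernelSlabSoundOn_iff.mp hD _ hℓD haD
  have hTD := kernelSlabSoundAtP_reverse (kernelSlabSoundAtP_sym_env (ℓ' := revLetters (2 * (H₀ : ℤ)) ℓ'') hσD
    (fun m => hcohD _ (hℓR m).1 (hℓR m).2) (pinRep_spec hℓD haD) (fun m => hgD _ (hℓR m).1 (hℓR m).2) hPD)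
  exact ⟨_, _, fun m hm => far_of_coverUD hcov hM m hm, kernelSlabSoundAtP_append hTU hTD (disj_of_disjUD hdisj)⟩

/-! ### §2 the finite key box of valid piece keys -/

/-- the KEY BOX: start layer within `R` of the centre, planar offsets at most `G`, layer offset at most `Mp`. [g101] -/
def InKeyBox (H₀ R G Mp : ℕ) (k : ℤ × ℤ × ℤ × ℤ) : Prop := |k.1 - H₀| ≤ R ∧ |k.2.1| ≤ G ∧ |k.2.2.1| ≤ G ∧ |k.2.2.2| ≤ Mp

/-- the key box is stable under the reversal of keys. [g101] -/
theorem inKeyBox_revKey {H₀ R G Mp : ℕ} {k : ℤ × ℤ × ℤ × ℤ} (h : InKeyBox H₀ R G Mp k) : InKeyBox H₀ R G Mp (revKey H₀ k) := by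
  obtain ⟨d, a, b, m⟩ := k
  obtain ⟨h1, h2, h3, h4⟩ := h
  refine ⟨?_, h2, h3, ?_⟩
  · simp only [revKey] at h1 ⊢
    rw [show (2 * (H₀ : ℤ) - d - H₀) = -(d - H₀) by ring, abs_neg]
    exact h1
  · simp only [revKey] at h4 ⊢
    rw [abs_neg]
    exact h4

/-- `3a² ≤ 4·n9` and `3b² ≤ 4·n9` for the two refined planar offsets `a`, `b` of a pair. [folklore] -/
theorem three_sq_le_four_n9F (ℓ : ℤ → ℤ) (x : (Cell 2 × ℤ) × (Cell 2 × ℤ)) :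
    3 * (refF0 ℓ x.2 - refF0 ℓ x.1) ^ 2 ≤ 4 * n9F ℓ x ∧ 3 * (refF1 ℓ x.2 - refF1 ℓ x.1) ^ 2 ≤ 4 * n9F ℓ x := by
  simp only [n9F]
  constructor
  · nlinarith [sq_nonneg ((refF0 ℓ x.2 - refF0 ℓ x.1) + 2 * (refF1 ℓ x.2 - refF1 ℓ x.1)), sq_nonneg (x.2.2 - x.1.2)]
  · nlinarith [sq_nonneg (2 * (refF0 ℓ x.2 - refF0 ℓ x.1) + (refF1 ℓ x.2 - refF1 ℓ x.1)), sq_nonneg (x.2.2 - x.1.2)]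

/-- a pair with `n9 ≤ P` and `4P < 3(3G+1)²` has planar cell offsets at most `G`. [folklore] -/
theorem abs_dg_le_of_n9F_le {ℓ : ℤ → ℤ} (hℓ : IsLetterSeq ℓ) {x : (Cell 2 × ℤ) × (Cell 2 × ℤ)} {P : ℤ} {G : ℕ} (hx : n9F ℓ x ≤ P)
    (hG : 4 * P < 3 * (3 * (G : ℤ) + 1) ^ 2) : |x.2.1 0 - x.1.1 0| ≤ G ∧ |x.2.1 1 - x.1.1 1| ≤ G := by
  obtain ⟨h0, h1⟩ := three_sq_le_four_n9F ℓ x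
  have hl1 := hℓ x.1.2
  have hl2 := hℓ x.2.2
  simp only [refF0, refF1] at h0 h1
  constructor
  · have hsq : (3 * x.2.1 0 + ℓ x.2.2 - (3 * x.1.1 0 + ℓ x.1.2)) ^ 2 < (3 * (G : ℤ) + 1) ^ 2 := by nlinarith
    have ha := abs_lt_of_sq_lt_sq hsq (by positivity)
    rw [abs_lt] at ha
    rw [abs_le]
    constructor <;> omega
  · have hsq : (3 * x.2.1 1 + ℓ x.2.2 - (3 * x.1.1 1 + ℓ x.1.2)) ^ 2 < (3 * (G : ℤ) + 1) ^ 2 := by nlinarith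
    have ha := abs_lt_of_sq_lt_sq hsq (by positivity)
    rw [abs_lt] at ha
    rw [abs_le]
    constructor <;> omega

/-- ★ the raw key of a piece within `R` layers of the centre with `n9 ≤ P` lies in the key box. [g101] -/
theorem pieceKeyF_inKeyBox {ℓ : ℤ → ℤ} (hℓ : IsLetterSeq ℓ) {H₀ R G Mp : ℕ} {P : ℤ} {q : (Cell 2 × ℤ) × (Cell 2 × ℤ)}
    (hd : |q.1.2 - (H₀ : ℤ)| ≤ R) (hx : n9F ℓ q ≤ P) (hG : 4 * P < 3 * (3 * (G : ℤ) + 1) ^ 2) (hMp : P < 6 * ((Mp : ℤ) + 1) ^ 2) :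
    InKeyBox H₀ R G Mp (pieceKeyF q) := by
  obtain ⟨h0, h1⟩ := abs_dg_le_of_n9F_le hℓ hx hG
  exact ⟨hd, h0, h1, abs_layers_le_of_n9F_le hx hMp⟩

/-- ★ OFF THE BOX THE GUARDED IDEAL TABLES VANISH (pieces of in-range chords are within `R` layers and have `n9 ≤ P9max`). [g101] -/
theorem thetaR0G_eq_zero_off {ℓ : ℤ → ℤ} (hℓ : IsLetterSeq ℓ) {H₀ R G Mp : ℕ} {lo hi P9max : ℤ} {cd : List ChordDatum}
    (hV : ∀ c ∈ cd, PiecesWithin H₀ R c ∧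
      (lo < n9F ℓ c.1 → n9F ℓ c.1 ≤ hi → ∀ i < chordNp c, 0 < n9F ℓ (chordPiece c i) ∧ n9F ℓ (chordPiece c i) ≤ P9max))
    (hG : 4 * P9max < 3 * (3 * (G : ℤ) + 1) ^ 2) (hMp : P9max < 6 * ((Mp : ℤ) + 1) ^ 2) {k : ℤ × ℤ × ℤ × ℤ}
    (hk : ¬ InKeyBox H₀ R G Mp k) : thetaR0G ℓ lo hi cd k = 0 ∧ thetaN0G ℓ lo hi cd k = 0 := by
  have key : ∀ c ∈ cd, lo < n9F ℓ c.1 ∧ n9F ℓ c.1 ≤ hi → ∀ i ∈ Finset.range (chordNp c), pieceKeyF (chordPiece c i) ≠ k := by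
    intro c hc hr i hi heq
    obtain ⟨hW, hP⟩ := hV c hc
    have hi' := Finset.mem_range.mp hi
    exact hk (heq ▸ pieceKeyF_inKeyBox hℓ (hW i hi').1 (hP hr.1 hr.2 i hi').2 hG hMp)
  constructor
  · unfold thetaR0G
    apply List.sum_eq_zero
    intro t ht
    obtain ⟨c, hc, rfl⟩ := List.mem_map.mp ht
    split_ifs with hr
    · exact Finset.sum_eq_zero fun i hi => if_neg (key c hc hr i hi)
    · rfl
  · unfold thetaN0G
    apply List.sum_eq_zero
    intro t ht
    obtain ⟨c, hc, rfl⟩ := List.mem_map.mp ht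
    split_ifs with hr
    · exact Finset.sum_eq_zero fun i hi => if_neg (key c hc hr i hi)
    · rfl

/-- ★★ DOMINATION ON THE BOX SUFFICES: tables dominating the type's tables on the key box (and nonnegative) carry the type contract. [g101] -/
theorem kernelSlabSoundFE_mono_on {H₀ R E G Mp : ℕ} {wd : List ℤ} {lo hi P9max : ℤ} {TRz TNz TR' TN' : ℤ × ℤ × ℤ × ℤ → ℤ}
    (hG : 4 * P9max < 3 * (3 * (G : ℤ) + 1) ^ 2) (hMp : P9max < 6 * ((Mp : ℤ) + 1) ^ 2)
    (hR : ∀ k, InKeyBox H₀ R G Mp k → TRz k ≤ TR' k) (hN : ∀ k, InKeyBox H₀ R G Mp k → TNz k ≤ TN' k)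
    (hR0 : ∀ k, 0 ≤ TR' k) (hN0 : ∀ k, 0 ≤ TN' k) (h : KernelSlabSoundFE H₀ R wd lo hi P9max E TRz TNz) :
    KernelSlabSoundFE H₀ R wd lo hi P9max E TR' TN' := by
  intro ℓ hℓ hag
  obtain ⟨cd, hV, hT⟩ := h ℓ hℓ hag
  refine ⟨cd, hV, fun k => ?_⟩
  by_cases hk : InKeyBox H₀ R G Mp k
  · exact ⟨(hT k).1.trans (div_le_div_of_nonneg_right (by exact_mod_cast hR k hk) (by positivity)),
      (hT k).2.trans (div_le_div_of_nonneg_right (by exact_mod_cast hN k hk) (by positivity))⟩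
  · obtain ⟨h0, h1⟩ := thetaR0G_eq_zero_off hℓ (fun c hc => ⟨(hV.1 c hc).2.1, (hV.1 c hc).2.2⟩) hG hMp hk
    rw [h0, h1]
    exact ⟨div_nonneg (by exact_mod_cast hR0 k) (by positivity), div_nonneg (by exact_mod_cast hN0 k) (by positivity)⟩

/-- the box literals at the production parameters `P9max = 97`: `G = 4`, `Mp = 4` (`388 < 507`, `97 < 150`). [g101] -/
example : 4 * (97 : ℤ) < 3 * (3 * ((4 : ℕ) : ℤ) + 1) ^ 2 ∧ (97 : ℤ) < 6 * (((4 : ℕ) : ℤ) + 1) ^ 2 := by norm_num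

/-! ### §3 tree lookups and the common tables of design (i) -/

/-- R payload at code `q` by search-tree descent (`0` if absent; recursor form). [g101] -/
noncomputable def PT.findR (q : ℕ) (t : PT) : ℕ :=
  PT.rec (motive := fun _ => ℕ) 0 (fun _ k a _ _ fl frt => bif Nat.blt q k then fl else bif Nat.blt k q then frt else a) t
/-- N payload at code `q` by search-tree descent. [g101] -/
noncomputable def PT.findN (q : ℕ) (t : PT) : ℕ :=
  PT.rec (motive := fun _ => ℕ) 0 (fun _ k _ b _ fl frt => bif Nat.blt q k then fl else bif Nat.blt k q then frt else b) t

/-- ★ THE COMMON R TABLE of design (i): the up tree at the key's code plus the down tree at the reflected key's code. [g101] -/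
noncomputable def comTR (H₀ : ℕ) (BU BD : PT) (k : ℤ × ℤ × ℤ × ℤ) : ℤ :=
  (PT.findR (codeKO k) BU : ℤ) + (PT.findR (codeKO (revKey H₀ k)) BD : ℤ)
/-- ★ THE COMMON N TABLE of design (i). [g101] -/
noncomputable def comTN (H₀ : ℕ) (BU BD : PT) (k : ℤ × ℤ × ℤ × ℤ) : ℤ :=
  (PT.findN (codeKO k) BU : ℤ) + (PT.findN (codeKO (revKey H₀ k)) BD : ℤ)

/-- the common tables are nonnegative. [g101] -/
theorem comTR_nonneg (H₀ : ℕ) (BU BD : PT) (k : ℤ × ℤ × ℤ × ℤ) : 0 ≤ comTR H₀ BU BD k ∧ 0 ≤ comTN H₀ BU BD k := by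
  unfold comTR comTN
  constructor <;> positivity

/-! ### §4 strictly increasing codes (the certificate checks it; an entry then carries the key-wise sum) -/

/-- strictly increasing codes (checked once per certificate). [g101] -/
def strictCodes : List (ℕ × ℕ × ℕ) → Bool
  | e :: f :: r => Nat.blt e.1 f.1 && strictCodes (f :: r)
  | _ => true

/-- strictly increasing codes are pairwise increasing. [folklore] -/
theorem pairwise_lt_of_strictCodes : ∀ {L : List (ℕ × ℕ × ℕ)}, strictCodes L = true → (L.map (·.1)).Pairwise (· < ·)
  | [], _ => List.Pairwise.nil
  | [e], _ => by simp
  | e :: f :: r, h => by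
    unfold strictCodes at h
    rw [Bool.and_eq_true] at h
    have hef : e.1 < f.1 := by simpa only [Nat.blt_eq] using h.1
    have ih := pairwise_lt_of_strictCodes h.2
    rw [List.map_cons] at ih
    rw [List.map_cons, List.map_cons, List.pairwise_cons]
    refine ⟨fun c hc => ?_, ih⟩
    rcases List.mem_cons.mp hc with rfl | hc'
    · exact hef
    · exact hef.trans ((List.pairwise_cons.mp ih).1 c hc')

/-- a code absent from the table has zero sums. [folklore] -/
theorem tab_eq_zero_of_ne {L : List (ℕ × ℕ × ℕ)} {q : ℕ} (h : ∀ e ∈ L, e.1 ≠ q) : tabR L q = 0 ∧ tabN L q = 0 := by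
  induction L with
  | nil => simp [tabR, tabN]
  | cons f L ih =>
    have hf := h f (by simp)
    obtain ⟨i1, i2⟩ := ih fun e he => h e (by simp [he])
    simp [tabR_cons, tabN_cons, hf, i1, i2]

/-- ★ with pairwise distinct codes an entry's payload IS the key-wise sum at its code. [folklore] -/
theorem tab_self {L : List (ℕ × ℕ × ℕ)} (hp : (L.map (·.1)).Pairwise (· ≠ ·)) {e : ℕ × ℕ × ℕ} (he : e ∈ L) :
    tabR L e.1 = e.2.1 ∧ tabN L e.1 = e.2.2 := by
  induction L with
  | nil => simp at he
  | cons f L ih =>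
    rw [List.map_cons, List.pairwise_cons] at hp
    rcases List.mem_cons.mp he with rfl | he'
    · obtain ⟨z1, z2⟩ := tab_eq_zero_of_ne (L := L) (q := e.1) fun e' he' heq =>
        hp.1 e'.1 (List.mem_map.mpr ⟨e', he', rfl⟩) heq.symm
      simp [tabR_cons, tabN_cons, z1, z2]
    · have hne : f.1 ≠ e.1 := hp.1 e.1 (List.mem_map.mpr ⟨e, he', rfl⟩)
      obtain ⟨i1, i2⟩ := ih hp.2 he'
      simp [tabR_cons, tabN_cons, hne, i1, i2]

/-- a code with a nonzero sum is the code of some entry. [folklore] -/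
theorem exists_entry_of_ne {L : List (ℕ × ℕ × ℕ)} {q : ℕ} (h : tabR L q ≠ 0 ∨ tabN L q ≠ 0) : ∃ e ∈ L, e.1 = q := by
  by_contra hne
  obtain ⟨z1, z2⟩ := tab_eq_zero_of_ne (L := L) (q := q) fun e he heq => hne ⟨e, he, heq⟩
  exact h.elim (fun h1 => h1 z1) fun h2 => h2 z2

end Summit.AtomisticToContinuum.Crystallization.Theorems.ChartedZeroExcessLayeredLatticeLiouville.ThetaKernel
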